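import Summits.CriticalPhenomena.PercolationContinuityZ3.Theorems.PercNearOneGluingNoHeavyLowerTailSahiHereditaryMeetAbsorption
import Summits.CriticalPhenomena.PercolationContinuityZ3.Theorems.PercNearOneGluingNoHeavyLowerTailSahiE4MeetTower
import Literature.Combinatorics.Sahi2008.Percolation
import HarnessLib

/-!
# `NoHeavyLowerTail` (stmt-CriticalPhenomena-4575) — REDUCTION TO THE HARD CORE at all orders: only the hard-core sub-triples and fourwise absorption matter

Support file, seat `prim-l12-p5` (gen 4), `--supports stmt-CriticalPhenomena-4575`.  No definitions, no named facts, no sorries.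
Uses `…SahiDefectExpansion` (Theorem E `sahiE_cons_nonneg_of_absorbs_top`), `…SahiHereditaryMeetAbsorption` (`exists_absorber_of_cardwise`,
`exists_absorber_ind`), `…SahiE3MeetContainment` (Theorem C: a triple in which one slot contains the meet of the other two has `E₃ ≥ 0`,
`SahiMeetContainment.sahiE_three_nonneg_of_mul_le`) and `…SahiE4MeetTower` (`sahiE_three_swap₂₃`).

The lane's HARD CORE: a triple of monotone indicators in which EVERY slot misses part of the product of the other two (no meet containment); on
`{0,1}^4` these are 6.8 % of the multiset triples (54 321 of 804 440), at `k = 5` 23–27 % (ttrl §712); everything else at order 3 is Harris-elementary.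

* **Theorem G′** `sahiE_nonneg_of_small_of_absorbing` (any nonnegative probability weight, any `[0,1]`-valued slots — NO monotonicity, no lattice):
  if every nonempty sub-family of size `≤ k` has `E ≥ 0` and every sub-family of size `≥ k + 1` is meet-absorbing (some member `p` with
  `(1 − g_p)·∏_{i≠p} g_i = 0`), then `E_m(g) ≥ 0` — strong induction on `m` with Theorem E; the positivity input is only about THIS family's small
  sub-families (transported along increasing enumerations: `subfamily_map_orderEmb`, `subfamily_three_eq`).
* **Theorem H — REDUCTION TO THE HARD CORE** `sahiE_nonneg_of_hardCore_of_fourwise` (FKG probability weight on a finite distributive lattice, monotone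
  indicators): if (a) every HARD-CORE sub-triple `i < j < k` has `E₃(g_i,g_j,g_k) ≥ 0` — by whatever means: a principal/cumulation slot (Sahi's
  Theorem 2), a small-cube certificate, a sunflower, … — and (b) among any FOUR slots one absorbs the product of the other three, then `E_m(g) ≥ 0`
  for every `m`.  Pairs are FKG, meet-contained triples are Theorem C, the rest is G′ at `k = 3`.  With no hard-core triple at all this is Theorem F
  (`…SahiHereditaryMeetAbsorption`); Theorem H says precisely that AT EVERY ORDER the only inputs Sahi's conjecture needs beyond Harris are `C_3` on
  the hard-core triples and fourwise absorption (which holds for 97–99.7 % of the 4..6-families of up-sets on `{0,1}^4`, seat census).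
* `bernoulliWeight_sahiE_ind_nonneg_of_hardCore_of_fourwise` — Kahn's setting: product measure on `2^ι`, increasing events; hypothesis (a) as
  `0 ≤ sahiE3 (prodBernoulli p) (A_i) (A_j) (A_k)` for the hard-core triples (none of the three contains the intersection of the other two), (b) with sets.
-/

namespace Summit.CriticalPhenomena.PercolationContinuityZ3.Theorems

namespace SahiHereditaryMeetAbsorption

open Finset Function Literature.Combinatorics.Sahi2008 SahiMomentExpansion SahiDefectExpansion
open scoped Nat

variable {α : Type*} [Fintype α]

/-! ### Reduction to the hard core at all orders: only the HARD-CORE sub-triples and fourwise absorption matter -/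

section HardCore

/-- Sub-family along an order embedding `e : Fin a ↪o Fin b`: the sub-family of `h` indexed by `S'.map e` is the sub-family of `h ∘ e` indexed by
`S'`. [folklore] -/
theorem subfamily_map_orderEmb (μ : α → ℝ) {a b : ℕ} (e : Fin a ↪o Fin b) (S' : Finset (Fin a)) (h : Fin b → α → ℝ) :
    sahiE μ (S'.map e.toEmbedding).card (fun j => h ((S'.map e.toEmbedding).orderEmbOfFin rfl j))
      = sahiE μ S'.card (fun j => h (e (S'.orderEmbOfFin rfl j))) := by
  have hc : S'.card = (S'.map e.toEmbedding).card := (card_map _).symm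
  rw [← sahiE_cast μ hc]
  congr 1
  funext j
  have e1 : (S'.map e.toEmbedding).orderEmbOfFin rfl (Fin.cast hc j)
      = (S'.map e.toEmbedding).orderEmbOfFin (card_map _) j :=
    Finset.orderEmbOfFin_eq_orderEmbOfFin_iff.mpr rfl
  have e2 : (fun j => e (S'.orderEmbOfFin rfl j)) = (S'.map e.toEmbedding).orderEmbOfFin (card_map _) :=
    Finset.orderEmbOfFin_unique _ (fun j => (Finset.mem_map' e.toEmbedding).mpr (orderEmbOfFin_mem _ _ _))
      (e.strictMono.comp (S'.orderEmbOfFin rfl).strictMono)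
  have e2' : e (S'.orderEmbOfFin rfl j) = (S'.map e.toEmbedding).orderEmbOfFin (card_map _) j := congrFun e2 j
  rw [e1, ← e2']

/-- A three-element sub-family in increasing enumeration is the literal triple `![g_{e 0}, g_{e 1}, g_{e 2}]`, `e = S.orderEmbOfFin`. [folklore] -/
theorem subfamily_three_eq (μ : α → ℝ) {N : ℕ} (g : Fin N → α → ℝ) (S : Finset (Fin N)) (hS : S.card = 3) :
    sahiE μ S.card (fun j => g (S.orderEmbOfFin rfl j))
      = sahiE μ 3 ![g (S.orderEmbOfFin hS 0), g (S.orderEmbOfFin hS 1), g (S.orderEmbOfFin hS 2)] := by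
  rw [← sahiE_cast μ hS.symm]
  congr 1
  funext j
  have e1 : S.orderEmbOfFin rfl (Fin.cast hS.symm j) = S.orderEmbOfFin hS j :=
    Finset.orderEmbOfFin_eq_orderEmbOfFin_iff.mpr rfl
  rw [e1]
  fin_cases j <;> rfl

/-- **Small orders from the family, all orders from absorption ("Theorem G′").**  Nonnegative probability weight; `0 ≤ g_i ≤ 1` (no monotonicity!);
if every NONEMPTY sub-family of size `≤ k` has `E ≥ 0` and every sub-family of size `≥ k + 1` is meet-absorbing (`k ≥ 1`), then `E_m(g) ≥ 0`.
Pure sign bookkeeping on the defect expansion: strong induction on `m` via Theorem E. [this file] -/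
theorem sahiE_nonneg_of_small_of_absorbing {μ : α → ℝ} (hμ0 : ∀ a, 0 ≤ μ a) (hμ1 : ∑ a, μ a = 1) {k : ℕ} (hk1 : 1 ≤ k) :
    ∀ (m : ℕ) (g : Fin m → α → ℝ), (∀ i a, 0 ≤ g i a) → (∀ i a, g i a ≤ 1) →
      (∀ S : Finset (Fin m), S.Nonempty → S.card ≤ k → 0 ≤ sahiE μ S.card (fun j => g (S.orderEmbOfFin rfl j))) →
      (∀ S : Finset (Fin m), k + 1 ≤ S.card → ∃ p ∈ S, ∀ x, (1 - g p x) * ∏ i ∈ S.erase p, g i x = 0) →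
      0 ≤ sahiE μ m g := by
  intro m
  induction m using Nat.strong_induction_on with
  | _ m ih =>
    intro g hg0 hg1 hsmall habs
    rcases Nat.lt_or_ge m (k + 1) with hm | hm
    · rcases Nat.eq_zero_or_pos m with h0 | hpos
      · subst h0
        rw [sahiE_zero]
      · have key := hsmall univ (Finset.univ_nonempty_iff.mpr (Fin.pos_iff_nonempty.mp hpos)) (by simpa using Nat.lt_succ_iff.mp hm)
        rwa [subfamily_univ] at key
    · obtain ⟨n, rfl⟩ := Nat.exists_eq_add_of_le' (show 2 ≤ m by omega)
      obtain ⟨p, _, hp⟩ := habs univ (by simpa using hm)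
      have hmove : sahiE μ (n + 2) g
          = sahiE μ (n + 2) (Fin.cons (g p) (p.removeNth g) : Fin (n + 2) → α → ℝ) := by
        conv_lhs => rw [← update_eq_self p g]
        exact SahiMeetTowerAll.sahiE_update_eq_sahiE_cons μ (n + 1) g p (g p)
      rw [hmove]
      refine sahiE_cons_nonneg_of_absorbs_top hμ0 hμ1 n (g p) (p.removeNth g) (fun i x => hg0 _ x) (hg1 p) ?_ ?_
      · intro x
        have key := hp x
        have e : (univ : Finset (Fin (n + 2))).erase p = univ.image p.succAbove := by
          rw [← Finset.compl_singleton, ← Fin.image_succAbove_univ]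
        rw [e, Finset.prod_image (fun i _ j _ h => Fin.succAbove_right_injective h)] at key
        simpa only [Fin.removeNth] using key
      · intro T _
        -- the sub-family `h = (p.removeNth g)|Tᶜ`, increasing enumeration `e`
        let e : Fin Tᶜ.card ↪o Fin (n + 2) := (Tᶜ.orderEmbOfFin rfl).trans (Fin.succAboveOrderEmb p)
        have he : ∀ j, e j = p.succAbove (Tᶜ.orderEmbOfFin rfl j) := fun j => rfl
        refine ih Tᶜ.card ((Finset.card_le_univ _).trans_lt (by simp)) _ (fun j x => hg0 _ x) (fun j x => hg1 _ x) ?_ ?_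
        · -- small sub-families of `h` are small sub-families of `g`
          intro S' hS'ne hS'k
          have key := hsmall (S'.map e.toEmbedding) (by simpa using hS'ne) (by rwa [Finset.card_map])
          rw [subfamily_map_orderEmb] at key
          simpa only [he, Fin.removeNth] using key
        · intro S' hS'
          obtain ⟨q, hq, hq'⟩ := habs (S'.map e.toEmbedding) (by rwa [Finset.card_map])
          obtain ⟨q', hq'S, rfl⟩ := Finset.mem_map.mp hq
          refine ⟨q', hq'S, fun x => ?_⟩
          have key := hq' x
          rw [← Finset.map_erase, Finset.prod_map] at key
          simpa only [RelEmbedding.coe_toEmbedding, he, Fin.removeNth] using key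

variable [DistribLattice α]

omit [DistribLattice α] in
/-- `E₃` with the first two slots swapped (plumbing). [folklore] -/
theorem sahiE_three_swap₁₂ (μ : α → ℝ) (a b c : α → ℝ) : sahiE μ 3 ![a, b, c] = sahiE μ 3 ![b, a, c] := by
  rw [sahiE_three, sahiE_three, mul_comm a b]
  ring

/-- **REDUCTION TO THE HARD CORE, all orders ("Theorem H").**  FKG probability weight on a finite distributive lattice; monotone indicators
`g_0,…,g_{m−1}`.  Suppose (a) every HARD-CORE sub-triple `i < j < k` (no slot contains the product of the other two) has `E₃(g_i, g_j, g_k) ≥ 0`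
(by whatever means: a principal slot, a small-cube certificate, …), and (b) among any FOUR slots one absorbs the product of the other three.  Then
`E_m(g) ≥ 0`.  (Pairs: FKG; meet-contained triples: `…SahiE3MeetContainment`; the rest is Theorem G′ at `k = 3`.) [this file] -/
theorem sahiE_nonneg_of_hardCore_of_fourwise {μ : α → ℝ} (hμ : IsFKGMeasure μ) (m : ℕ) (g : Fin m → α → ℝ)
    (h01 : ∀ i a, g i a = 0 ∨ g i a = 1) (hmono : ∀ i, Monotone (g i))
    (hcore : ∀ i j k : Fin m, i < j → j < k → (¬ ∀ x, g j x * g k x ≤ g i x) → (¬ ∀ x, g i x * g k x ≤ g j x) →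
      (¬ ∀ x, g i x * g j x ≤ g k x) → 0 ≤ sahiE μ 3 ![g i, g j, g k])
    (h4 : ∀ S : Finset (Fin m), S.card = 4 → ∃ p ∈ S, ∀ x, (1 - g p x) * ∏ i ∈ S.erase p, g i x = 0) :
    0 ≤ sahiE μ m g := by
  have hg0 : ∀ i x, 0 ≤ g i x := fun i x => by rcases h01 i x with e | e <;> simp [e]
  have hg1 : ∀ i x, g i x ≤ 1 := fun i x => by rcases h01 i x with e | e <;> simp [e]
  -- every triple is nonnegative: meet-contained ones by `…SahiE3MeetContainment`, the others by (a)
  have htri : ∀ i j k : Fin m, i < j → j < k → 0 ≤ sahiE μ 3 ![g i, g j, g k] := by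
    intro i j k hij hjk
    by_cases hA : ∀ x, g j x * g k x ≤ g i x
    · rw [sahiE_three_swap₁₂]
      exact SahiMeetContainment.sahiE_three_nonneg_of_mul_le hμ (g j) (g i) (g k) (h01 j) (h01 k) (hg1 i) (hmono j) (hmono k) hA
    by_cases hB : ∀ x, g i x * g k x ≤ g j x
    · exact SahiMeetContainment.sahiE_three_nonneg_of_mul_le hμ (g i) (g j) (g k) (h01 i) (h01 k) (hg1 j) (hmono i) (hmono k) hB
    by_cases hC : ∀ x, g i x * g j x ≤ g k x
    · rw [SahiMeetTower.sahiE_three_swap₂₃]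
      exact SahiMeetContainment.sahiE_three_nonneg_of_mul_le hμ (g i) (g k) (g j) (h01 i) (h01 j) (hg1 k) (hmono i) (hmono j) hC
    exact hcore i j k hij hjk hA hB hC
  refine sahiE_nonneg_of_small_of_absorbing hμ.nonneg hμ.sum_eq_one (by norm_num : 1 ≤ 3) m g hg0 hg1 ?_
    (fun S hS => exists_absorber_of_cardwise g h4 S hS)
  intro S hSne hS3
  -- |S| ∈ {1, 2, 3}
  have hS1 : 1 ≤ S.card := Finset.card_pos.mpr hSne
  rcases (show S.card = 1 ∨ S.card = 2 ∨ S.card = 3 by omega) with h1 | h2 | h3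
  · rw [← sahiE_cast μ h1.symm, sahiE_one_apply]
    exact ex_nonneg hμ.nonneg (hg0 _)
  · rw [← sahiE_cast μ h2.symm, sahiE_two_apply, sub_nonneg]
    exact ex_mul_ex_le_ex_mul hμ (hg0 _) (hg0 _) (hmono _) (hmono _)
  · rw [subfamily_three_eq μ g S h3]
    exact htri _ _ _ ((S.orderEmbOfFin h3).strictMono (by decide)) ((S.orderEmbOfFin h3).strictMono (by decide))

end HardCore

section HardCoreProduct

open Literature.Probability.Percolation.DecisionTree (ind ind_of_mem ind_of_not_mem ind_nonneg)
open Literature.Probability.LatticeModels (prodBernoulli sahiE3)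

/-- **Reduction to the hard core, Kahn's setting**: product measure on `2^ι`, increasing events `A_0,…,A_{m−1}`.  If every hard-core sub-triple
`i < j < k` (none of the three contains the intersection of the other two) has `sahiE3 (prodBernoulli p) (A_i) (A_j) (A_k) ≥ 0`, and among any
four events one contains the intersection of the other three, then `E_m(1_{A_0},…,1_{A_{m−1}}) ≥ 0` (every `m`). [this file] -/
theorem bernoulliWeight_sahiE_ind_nonneg_of_hardCore_of_fourwise {ι : Type*} [Fintype ι] (p : ι → unitInterval) (m : ℕ)
    (A : Fin m → Set (Set ι)) (hA : ∀ i, IsUpperSet (A i))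
    (hcore : ∀ i j k : Fin m, i < j → j < k → ¬ (A j ∩ A k ⊆ A i) → ¬ (A i ∩ A k ⊆ A j) → ¬ (A i ∩ A j ⊆ A k) →
      0 ≤ sahiE3 (prodBernoulli p) (A i) (A j) (A k))
    (h4 : ∀ S : Finset (Fin m), S.card = 4 → ∃ q ∈ S, ∀ ω, (∀ i ∈ S.erase q, ω ∈ A i) → ω ∈ A q) :
    0 ≤ sahiE (bernoulliWeight p) m (fun i => ind (A i)) := by
  have hind : ∀ (X Y Z : Set (Set ι)), (∀ ω, ind X ω * ind Y ω ≤ ind Z ω) ↔ X ∩ Y ⊆ Z := by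
    intro X Y Z
    constructor
    · intro h ω ⟨hX, hY⟩
      have := h ω
      rw [ind_of_mem hX, ind_of_mem hY, one_mul] at this
      by_contra hZ
      rw [ind_of_not_mem hZ] at this
      exact absurd this (by norm_num)
    · intro h ω
      by_cases hX : ω ∈ X
      · by_cases hY : ω ∈ Y
        · rw [ind_of_mem hX, ind_of_mem hY, ind_of_mem (h ⟨hX, hY⟩), one_mul]
        · rw [ind_of_not_mem hY, mul_zero]; exact ind_nonneg _ _
      · rw [ind_of_not_mem hX, zero_mul]; exact ind_nonneg _ _
  refine sahiE_nonneg_of_hardCore_of_fourwise (isFKGMeasure_bernoulliWeight p) m _ (fun i ω => ?_)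
    (fun i => monotone_ind_of_isUpperSet (hA i)) (fun i j k hij hjk ha hb hc => ?_) fun S hS => exists_absorber_ind A S (h4 S hS)
  · by_cases h : ω ∈ A i
    · exact Or.inr (ind_of_mem h)
    · exact Or.inl (ind_of_not_mem h)
  · rw [sahiE_three_ind]
    exact hcore i j k hij hjk (fun h => ha ((hind _ _ _).mpr h)) (fun h => hb ((hind _ _ _).mpr h))
      (fun h => hc ((hind _ _ _).mpr h))

end HardCoreProduct

end SahiHereditaryMeetAbsorption

end Summit.CriticalPhenomena.PercolationContinuityZ3.Theorems
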